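import Literature.Probability.RandomPlanarGeometry.LoewnerImageFlowStep
import Literature.Probability.RandomPlanarGeometry.SLERestrictionStepAlive
import HarnessLib

/-!
# The conformal image of a Loewner chain along a driving function: the image driving function `W̃_t = h_t(W_t)` and the image flow `g̃_t`

[LSW] §5 (G. F. Lawler, O. Schramm, W. Werner, *Conformal restriction: the chordal case*, J. Amer.
Math. Soc. **16** (2003), before and in (5.1)): for a hull `A ∈ 𝒬*` with restriction map `Φ_A`
and a Loewner chain `(g_t)` driven by `W` whose hulls have not met `A`, "let `A_t = g_t(A)`,
`h_t = g_{A_t}` … `g̃_t := h_t ∘ g_t ∘ Φ_A⁻¹` (the normalized map of the image hull `Φ_A(K_t)`) …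
`W̃_t = h_t(W_t)` … `∂_t g̃_t(z) = 2 h_t'(W_t)² / (g̃_t(z) − W̃_t)` (5.1)"; G. F. Lawler (2005),
§4.6.1, Prop. 4.40–4.41 and (4.34). This file passes from the ONE-STEP statements of
`LoewnerImageStep*`, `LoewnerImageDriverStep`, `LoewnerImageFlowStep` (base hull `B`, increment
driver `U`) to the objects ALONG A DRIVING FUNCTION `W` (base time `s`, `B = B_s = A_s − W_s` the
slid hull `Loewner.slidHull W A s`, `U = W(s + ·) − W_s`), in canonical coordinates
(`starMap`, `starShift`, `starDeriv` of `StarHullCanonical`):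

* `imageDriver W A t = W_t + L_A − L_{B_t}` — **the image driving function `W̃_t = h_t(W_t) + L_A`**
  (`L = starShift`; `h_t(W_t) = g_{A_t}(W_t) = g_{B_t}(0) + W_t = W_t − L_{B_t}`; the additive
  constant `L_A` makes `g̃` hydrodynamically normalized and `W̃_0 = 0`);
* `imageFlow W A t z = E_{B_t}(g_t z − W_t) − L_{B_t} + W_t + L_A` — **the image flow
  `g̃_t(Φ_A(z)) = h_t(g_t(z)) + L_A`** of a point `z`, so that
  `imageFlow − imageDriver = E_{B_t}(g_t z − W_t)` (`imageFlow_sub_imageDriver`), `W̃_0 = 0`,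
  `g̃_0 = E_A = Φ_A` on `ℍ ∖ A` (`imageDriver_zero`, `imageFlow_zero`);
* **one step along the driver** (alive base time `s`, step `u` under the survival smallness of
  `SLERestrictionStepAlive`: `B_s` off `B(0, 8ρ₀)`, `osc_{[s,s+u]} W ≤ S`, `η = S + 4√u ≤ ρ₀`,
  `u ≤ (ρ₀/4)²`): `W̃_{s+u} − W̃_s = imageDriverStep B_s U u` and
  `g̃_{s+u}(ζ) − g̃_s(ζ) = imageFlowStep`-type displacement of `y = g_s z − W_s`
  (`imageDriver_add_sub`, `imageFlow_add_sub`: the cocycles `slidHull_add_eq`, `map_add`);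
* hence, transported from the one-step files: **`Im g̃_{s+u}(ζ) ≤ Im g̃_s(ζ)`** and positivity
  (`im_imageFlow_add_le`), `|W̃_{s+u} − W̃_s| ≤ 25u/ρ₀ + 2|W_{s+u} − W_s|`
  (`abs_imageDriver_add_sub_le`), `‖g̃_{s+u}(ζ) − g̃_s(ζ)‖ ≤ 20u/|g̃_s(ζ) − W̃_s|` and
  **`‖(g̃_{s+u}(ζ) − g̃_s(ζ)) − 2 d_s² u/(g̃_s(ζ) − W̃_s)‖ ≤ u(1000η/ρ₀ + 228u/ρ₀²)/|g̃_s(ζ) − W̃_s|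
  + 60uη/|g̃_s(ζ) − W̃_s|²`** (`norm_imageFlow_add_sub_sub_field_le`, `d_s = starDeriv B_s = h_s'(W_s)`),
  for `|g̃_s(ζ) − W̃_s| ≥ 4η`, `η ≤ d_s²ρ₀/2000` — [LSW] (5.1) over one step of the driving function.

* **`hasDerivWithinAt_imageFlow_Ici`** — consequently **`∂_t⁺ g̃_t(ζ) = 2 d_t²/(g̃_t(ζ) − W̃_t)` at
  every alive time `t`** for `z ∈ ℍ ∖ A` alive at `t` ([LSW] (5.1) as a right derivative; the
  oscillation of `W` on `[t, t + u]` and `4√u` tend to `0`, the base hull `B_t` being fixed).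

The identification of `g̃` with the Loewner chain of `W̃` in the clock `∫ d²` (two-sided
derivatives or right-derivative ODE uniqueness, continuity in `t` from the left through the local
tube of `RestrictionDerivTime`) is the sequel. No named fact; two definitions.

## References

* [LSW] 2003, §5 (A_t, h_t, g̃_t, W̃_t, (5.1)). [LawlerSchrammWerner2003Restriction]
* G. F. Lawler (2005), §4.6.1 Prop. 4.40–4.41, (4.34); Rem. 4.9, Lemma 4.13. [Lawler2005]
-/

noncomputable section

open Set Filter Metric Bornology Function
open _root_.Complex _root_.Topology _root_.Real
open UpperHalfPlane (upperHalfPlaneSet isOpen_upperHalfPlaneSet)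
open scoped ComplexConjugate NNReal

namespace Literature.Probability.RandomPlanarGeometry

namespace Loewner

variable {W : ℝ≥0 → ℝ} {A : Set ℂ}

/-! ### The image driving function and the image flow -/

/-- **The image driving function `W̃_t = h_t(W_t) + L_A = W_t + L_A − L_{B_t}`** of the conformal
image of the chain under `Φ_A` (`B_t = slidHull W A t`, `L = starShift`; [LSW] §5:
`W̃_t = h_t(W_t)`, `h_t = g_{A_t}`, up to the normalizing constant `L_A`).
[cite: LawlerSchrammWerner2003Restriction, §5 (W̃_t = h_t(W_t))] -/
def imageDriver (W : ℝ≥0 → ℝ) (A : Set ℂ) (t : ℝ≥0) : ℝ :=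
  W t + (starShift A).re - (starShift (slidHull W A t)).re

/-- **The image flow `g̃_t(Φ_A z) = h_t(g_t z) + L_A = E_{B_t}(g_t z − W_t) − L_{B_t} + W_t + L_A`**
of a point `z` ([LSW] §5: `g̃_t = h_t ∘ g_t ∘ Φ_A⁻¹`, the hydrodynamically normalized map of the
image hull `Φ_A(K_t)`). [cite: LawlerSchrammWerner2003Restriction, §5 (g̃_t)] -/
def imageFlow (W : ℝ≥0 → ℝ) (A : Set ℂ) (t : ℝ≥0) (z : ℂ) : ℂ :=
  starMap (slidHull W A t) (map W t z - W t) - starShift (slidHull W A t) + W t + starShift A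

/-- `L_B` is real for every set `B` (it is `hullShift` of a `*`-hull, or the junk value `0`).
[folklore] -/
theorem starShift_im_eq_zero (B : Set ℂ) : (starShift B).im = 0 := by
  by_cases h : IsStarHull B
  · exact starShift_im h
  · rw [starShift, dif_neg h, zero_im]

/-- `L_B = (L_B.re : ℂ)` for every set `B`. [folklore] -/
theorem starShift_eq_ofReal (B : Set ℂ) : starShift B = ((starShift B).re : ℂ) :=
  Complex.ext rfl (by rw [ofReal_im]; exact starShift_im_eq_zero B)

/-- **`g̃_t(ζ) − W̃_t = E_{B_t}(g_t z − W_t)`**: the image point seen from the image tip is the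
reflected map of the current slid hull at the current slid point. [cite: LawlerSchrammWerner2003Restriction, §5 (h_t = g_{A_t})] -/
theorem imageFlow_sub_imageDriver (t : ℝ≥0) (z : ℂ) :
    imageFlow W A t z - imageDriver W A t = starMap (slidHull W A t) (map W t z - W t) := by
  rw [imageFlow, imageDriver]
  push_cast
  rw [← starShift_eq_ofReal, ← starShift_eq_ofReal]
  ring

/-- At time `0` (driver starting at `0`, `0 ∉ A`) the slid hull is `A` itself. [folklore] -/
theorem slidHull_zero_of_zero (hW : Continuous W) (hW0 : W 0 = 0) (hA : IsStarHull A) : slidHull W A 0 = A := by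
  have h0 : ((W 0 : ℝ) : ℂ) ∉ A := by rw [hW0, ofReal_zero]; exact hA.2
  rw [slidHull_zero hW h0, hW0, ofReal_zero]
  simp

/-- **`W̃_0 = 0`.** [folklore] -/
theorem imageDriver_zero (hW : Continuous W) (hW0 : W 0 = 0) (hA : IsStarHull A) : imageDriver W A 0 = 0 := by
  rw [imageDriver, slidHull_zero_of_zero hW hW0 hA, hW0]; ring

/-- **`g̃_0 = E_A` off the driving point** (`= Φ_A` on `ℍ ∖ A`). [folklore] -/
theorem imageFlow_zero (hW : Continuous W) (hW0 : W 0 = 0) (hA : IsStarHull A) {z : ℂ} (hz : z ≠ 0) :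
    imageFlow W A 0 z = starMap A z := by
  have hz' : z ≠ W 0 := by rw [hW0, ofReal_zero]; exact hz
  rw [imageFlow, slidHull_zero_of_zero hW hW0 hA, map_zero_apply hW hz', hW0, ofReal_zero]; ring

/-! ### One step along the driving function -/

section Step

variable (hW : Continuous W) (hA : IsStarHull A) {s u : ℝ≥0} {ρ₀ S : ℝ}
  (hs : Disjoint (closedHull W s) A) (hρ₀ : 0 < ρ₀) (hBρ : Disjoint (ball (0 : ℂ) (8 * ρ₀)) (slidHull W A s))
  (hu : 0 < u) (hS : ∀ r : ℝ≥0, r ≤ u → |W (s + r) - W s| ≤ S) (hη : stepSize S u ≤ ρ₀)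
  (hu4 : (u : ℝ) ≤ (ρ₀ / 4) ^ 2)

/-- The increment driver `U = W(s + ·) − W_s` of the step. [folklore] -/
theorem shiftDriver_spec (hW : Continuous W) (s : ℝ≥0) :
    Continuous (fun r ↦ W (s + r) - W s) ∧ (fun r ↦ W (s + r) - W s) 0 = 0 ∧
      ∀ r : ℝ≥0, (fun r ↦ W (s + r) - W s) r = W (s + r) - W s :=
  ⟨(continuous_shiftDriver hW s).1, (continuous_shiftDriver hW s).2, fun _ ↦ rfl⟩

include hW hA hs hρ₀ hBρ hu hS hη hu4 in
/-- **`W̃_{s+u} − W̃_s = imageDriverStep B_s U u`** (the cocycle of slid hulls `B_{s+u} = slidHull U B_s u`).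
[cite: Lawler2005, Rem. 4.9] -/
theorem imageDriver_add_sub :
    imageDriver W A (s + u) - imageDriver W A s = imageDriverStep (slidHull W A s) (fun r ↦ W (s + r) - W s) u := by
  rw [imageDriver, imageDriver, imageDriverStep, slidHull_add_eq hW hA hs hρ₀ hBρ hu hS hη hu4]
  ring

include hW in
/-- **The point cocycle in slid coordinates**: for `z` alive at time `s + u`, with `y = g_s z − W_s`
and `U = W(s+·) − W_s`: `y` is alive at time `u` under `U` and `g_{s+u} z − W_{s+u} = g^U_u(y) − U_u`.
[cite: Lawler2005, Rem. 4.9] -/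
theorem map_add_sub_eq {z : ℂ} (hz : ((s + u : ℝ≥0) : WithTop ℝ≥0) < swallowingTime W z) :
    (u : WithTop ℝ≥0) < swallowingTime (fun r ↦ W (s + r) - W s) (map W s z - W s) ∧
      map W (s + u) z - W (s + u) =
        map (fun r ↦ W (s + r) - W s) u (map W s z - W s) - ((W (s + u) - W s : ℝ) : ℂ) := by
  obtain ⟨halive, hmap⟩ := map_add hW hz
  have hWs : Continuous fun r ↦ W (s + r) := continuous_shift W hW s
  have h1 := map_add_const hWs (-W s) halive
  have h2 := swallowingTime_add_const (fun r ↦ W (s + r)) (map W s z) (-W s)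
  simp only [Complex.ofReal_neg, ← sub_eq_add_neg] at h1 h2
  refine ⟨by rw [h2]; exact halive, ?_⟩
  rw [h1, hmap]
  push_cast
  ring

include hW hA hs hρ₀ hBρ hu hS hη hu4 in
/-- **`g̃_{s+u}(ζ) − g̃_s(ζ)` is the one-step displacement of the image flow** of `y = g_s z − W_s`
under `U`, in canonical coordinates:
`(E_{B'}(g^U_u y − U_u) − L_{B'} + U_u) − (E_B(y) − L_B)`, `B = B_s`, `B' = slidHull U B u = B_{s+u}`.
[cite: LawlerSchrammWerner2003Restriction, §5 (g̃_t)] -/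
theorem imageFlow_add_sub {z : ℂ} (hz : ((s + u : ℝ≥0) : WithTop ℝ≥0) < swallowingTime W z) :
    imageFlow W A (s + u) z - imageFlow W A s z =
      (starMap (slidHull (fun r ↦ W (s + r) - W s) (slidHull W A s) u)
          (map (fun r ↦ W (s + r) - W s) u (map W s z - W s) - ((W (s + u) - W s : ℝ) : ℂ)) -
        starShift (slidHull (fun r ↦ W (s + r) - W s) (slidHull W A s) u) + ((W (s + u) - W s : ℝ) : ℂ)) -
      (starMap (slidHull W A s) (map W s z - W s) - starShift (slidHull W A s)) := by
  obtain ⟨-, hpt⟩ := map_add_sub_eq hW hz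
  rw [imageFlow, imageFlow, slidHull_add_eq hW hA hs hρ₀ hBρ hu hS hη hu4, hpt]
  push_cast
  ring

/-! ### The one-step estimates, transported -/

include hW hA hs hρ₀ hBρ hu hS hη hu4 in
/-- **`|W̃_{s+u} − W̃_s| ≤ 25u/ρ₀ + 2|W_{s+u} − W_s|`** under the smallness `η ≤ d_s ρ₀/1000`
(`abs_imageDriverStep_le`): `t ↦ W̃_t` is right-continuous at alive times, with a modulus uniform in
the control constants. [cite: LawlerSchrammWerner2003Restriction, §5 (W̃ continuous)] -/
theorem abs_imageDriver_add_sub_le (hη' : stepSize S u ≤ starDeriv (slidHull W A s) * ρ₀ / 1000) :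
    |imageDriver W A (s + u) - imageDriver W A s| ≤ 25 * u / ρ₀ + 2 * |W (s + u) - W s| := by
  have hBs := isStarHull_slidHull_of_disjoint hW hA hs
  obtain ⟨hUc, hU0, -⟩ := shiftDriver_spec hW s
  rw [imageDriver_add_sub hW hA hs hρ₀ hBρ hu hS hη hu4]
  exact abs_imageDriverStep_le hBs hUc hU0 hu hS hρ₀ hBρ hη'

include hW hA hs hρ₀ hBρ hu hS hη hu4 in
/-- **The image flow lowers imaginary parts: `0 < Im g̃_{s+u}(ζ) ≤ Im g̃_s(ζ)`** for `z ∈ ℍ ∖ A`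
alive at `s + u`, under `η ≤ d_s ρ₀/1000` (`im_hmapT_map_le` with the canonical restriction maps;
`Im g̃ = Im E_{B}(·)` since the shifts are real). [cite: Lawler2005, §4.6.1 with Prop. 3.36] -/
theorem im_imageFlow_add_le (hη' : stepSize S u ≤ starDeriv (slidHull W A s) * ρ₀ / 1000) {z : ℂ}
    (hzH : 0 < z.im) (hzA : z ∉ A) (hz : ((s + u : ℝ≥0) : WithTop ℝ≥0) < swallowingTime W z) :
    0 < (imageFlow W A (s + u) z).im ∧ (imageFlow W A (s + u) z).im ≤ (imageFlow W A s z).im := by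
  have hBs := isStarHull_slidHull_of_disjoint hW hA hs
  obtain ⟨hUc, hU0, -⟩ := shiftDriver_spec hW s
  obtain ⟨hyu, -⟩ := map_add_sub_eq hW hz
  have hd := (starDeriv_spec hBs).2.2
  have hΦ := isRestrictionMap_starRMap hBs
  have hB' := isStarHull_slidHull_step hBs hUc hU0 hS hρ₀ hBρ hη
  have hΦ' := isRestrictionMap_starRMap hB'
  -- `y = g_s z − W_s ∈ ℍ ∖ B_s`
  have hsz : (s : WithTop ℝ≥0) < swallowingTime W z :=
    lt_of_le_of_lt (by exact_mod_cast (le_self_add : s ≤ s + u)) hz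
  have hzdom : z ∈ domain W s := (mem_domain_iff W s z).2 ⟨hzH, hsz⟩
  have hy : map W s z - W s ∈ upperHalfPlaneSet \ slidHull W A s := by
    refine ⟨?_, ?_⟩
    · show 0 < (map W s z - W s).im
      rw [sub_im, ofReal_im, sub_zero]; exact mapsTo_map hW s hzdom
    · rintro ⟨a, ha, hae⟩
      have haalive := lt_swallowingTime_of_alive hA hs ha
      have heq : map W s a = map W s z := by
        have := congrArg (· + (W s : ℂ)) hae; simpa using this
      have haim : 0 ≤ a.im := by
        have := hA.isBoundedHull.subset_closure ha
        rwa [show upperHalfPlaneSet = {z : ℂ | 0 < z.im} from rfl, Complex.closure_setOf_lt_im] at this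
      rcases haim.lt_or_eq with hapos | hazero
      · have hadom : a ∈ domain W s := (mem_domain_iff W s a).2 ⟨hapos, haalive⟩
        exact hzA ((injOn_map hW s hadom hzdom heq) ▸ ha)
      · have ha' : a = (((a.re : ℝ)) : ℂ) := Complex.ext rfl (by rw [ofReal_im]; exact hazero.symm)
        rw [ha'] at haalive heq
        have hreal : (map W s (a.re : ℝ)).im = 0 := map_ofReal_im hW haalive
        rw [heq] at hreal
        exact absurd hreal (ne_of_gt (mapsTo_map hW s hzdom))
  have key := im_hmapT_map_le hBs hΦ hd hUc hU0 hu hS hρ₀ hBρ hη' hΦ' hy hyu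
  rw [hmapT_starRMap hB', hmap_starRMap hBs] at key
  -- imaginary parts of the image flow
  have him1 : (imageFlow W A (s + u) z).im =
      (starMap (slidHull (fun r ↦ W (s + r) - W s) (slidHull W A s) u)
        (map (fun r ↦ W (s + r) - W s) u (map W s z - W s) - ((W (s + u) - W s : ℝ) : ℂ)) -
        starShift (slidHull (fun r ↦ W (s + r) - W s) (slidHull W A s) u) + ((W (s + u) - W s : ℝ) : ℂ)).im := by
    have h := imageFlow_add_sub hW hA hs hρ₀ hBρ hu hS hη hu4 hz
    have h2 : imageFlow W A (s + u) z = imageFlow W A s z + (imageFlow W A (s + u) z - imageFlow W A s z) := by ring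
    rw [h2, h, imageFlow]
    simp only [add_im, sub_im, ofReal_im, starShift_im_eq_zero, sub_zero, add_zero]
    ring
  have him0 : (imageFlow W A s z).im = (starMap (slidHull W A s) (map W s z - W s) - starShift (slidHull W A s)).im := by
    rw [imageFlow]
    simp only [add_im, sub_im, ofReal_im, starShift_im_eq_zero, sub_zero, add_zero]
  rw [him1, him0]
  exact key

include hW hA hs hρ₀ hBρ hu hS hη hu4 in
/-- **[LSW] (5.1) over one step of the driving function**: for `z ∈ ℍ ∖ A` alive at `s + u`, with
`E = g̃_s(ζ) − W̃_s = E_{B_s}(g_s z − W_s)`, `d_s = Φ'_{B_s}(0) = h_s'(W_s)`, `η = stepSize S u`,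
`|E| ≥ 4η` and `η ≤ d_s²ρ₀/2000`:

  `‖(g̃_{s+u}(ζ) − g̃_s(ζ)) − 2 d_s² u / E‖ ≤ u (1000η/ρ₀ + 228u/ρ₀²)/|E| + 60 u η/|E|²`,
  `‖g̃_{s+u}(ζ) − g̃_s(ζ)‖ ≤ 20 u/|E|`.

[cite: LawlerSchrammWerner2003Restriction, §5 (5.1); Lawler2005, (4.34)] -/
theorem norm_imageFlow_add_sub_sub_field_le (hη2 : stepSize S u ≤ starDeriv (slidHull W A s) ^ 2 * ρ₀ / 2000)
    {z : ℂ} (hzH : 0 < z.im) (hzA : z ∉ A) (hz : ((s + u : ℝ≥0) : WithTop ℝ≥0) < swallowingTime W z)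
    (hE : 4 * stepSize S u ≤ ‖imageFlow W A s z - imageDriver W A s‖) :
    ‖(imageFlow W A (s + u) z - imageFlow W A s z) -
        2 * (starDeriv (slidHull W A s) : ℂ) ^ 2 * u / (imageFlow W A s z - imageDriver W A s)‖ ≤
      u * (1000 * stepSize S u / ρ₀ + 228 * u / ρ₀ ^ 2) / ‖imageFlow W A s z - imageDriver W A s‖ +
        60 * u * stepSize S u / ‖imageFlow W A s z - imageDriver W A s‖ ^ 2 ∧
    ‖imageFlow W A (s + u) z - imageFlow W A s z‖ ≤ 20 * u / ‖imageFlow W A s z - imageDriver W A s‖ := by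
  have hBs := isStarHull_slidHull_of_disjoint hW hA hs
  obtain ⟨hUc, hU0, -⟩ := shiftDriver_spec hW s
  obtain ⟨hyu, -⟩ := map_add_sub_eq hW hz
  obtain ⟨hd0, hd1, hd⟩ := starDeriv_spec hBs
  have hΦ := isRestrictionMap_starRMap hBs
  have hB' := isStarHull_slidHull_step hBs hUc hU0 hS hρ₀ hBρ hη
  have hΦ' := isRestrictionMap_starRMap hB'
  have hη' : stepSize S u ≤ starDeriv (slidHull W A s) * ρ₀ / 1000 := by
    refine hη2.trans ?_
    rw [div_le_div_iff₀ (by norm_num) (by norm_num)]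
    have hdd : starDeriv (slidHull W A s) ^ 2 * ρ₀ ≤ starDeriv (slidHull W A s) * ρ₀ :=
      mul_le_mul_of_nonneg_right (by nlinarith) hρ₀.le
    nlinarith
  have hsz : (s : WithTop ℝ≥0) < swallowingTime W z :=
    lt_of_le_of_lt (by exact_mod_cast (le_self_add : s ≤ s + u)) hz
  have hzdom : z ∈ domain W s := (mem_domain_iff W s z).2 ⟨hzH, hsz⟩
  have hy : map W s z - W s ∈ upperHalfPlaneSet \ slidHull W A s := by
    refine ⟨?_, ?_⟩
    · show 0 < (map W s z - W s).im
      rw [sub_im, ofReal_im, sub_zero]; exact mapsTo_map hW s hzdom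
    · rintro ⟨a, ha, hae⟩
      have haalive := lt_swallowingTime_of_alive hA hs ha
      have heq : map W s a = map W s z := by
        have := congrArg (· + (W s : ℂ)) hae; simpa using this
      have haim : 0 ≤ a.im := by
        have := hA.isBoundedHull.subset_closure ha
        rwa [show upperHalfPlaneSet = {z : ℂ | 0 < z.im} from rfl, Complex.closure_setOf_lt_im] at this
      rcases haim.lt_or_eq with hapos | hazero
      · have hadom : a ∈ domain W s := (mem_domain_iff W s a).2 ⟨hapos, haalive⟩
        exact hzA ((injOn_map hW s hadom hzdom heq) ▸ ha)
      · have ha' : a = (((a.re : ℝ)) : ℂ) := Complex.ext rfl (by rw [ofReal_im]; exact hazero.symm)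
        rw [ha'] at haalive heq
        have hreal : (map W s (a.re : ℝ)).im = 0 := map_ofReal_im hW haalive
        rw [heq] at hreal
        exact absurd hreal (ne_of_gt (mapsTo_map hW s hzdom))
  -- the displacement is `imageFlowStep` of the canonical maps
  have hE_eq : imageFlow W A s z - imageDriver W A s = hullExt (starRMap _ hBs) (map W s z - W s) := by
    rw [imageFlow_sub_imageDriver, starMap_eq hBs]
  have hdisp : imageFlow W A (s + u) z - imageFlow W A s z =
      imageFlowStep (starRMap _ hBs) (starRMap _ hB') (map W s z - W s) := by
    rw [imageFlow_add_sub hW hA hs hρ₀ hBρ hu hS hη hu4 hz, imageFlowStep, hmapT_starRMap hB', hmap_starRMap hBs]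
  rw [hE_eq] at hE ⊢
  rw [hdisp]
  exact ⟨norm_imageFlowStep_sub_field_le hBs hΦ hd hUc hU0 hu hS hρ₀ hBρ hη' hΦ' hη2 hy hE,
    norm_imageFlowStep_le hBs hΦ hd hUc hU0 hu hS hρ₀ hBρ hη' hΦ' hη2 hy hE⟩

end Step

/-! ### The right derivative of the image flow at an alive time: [LSW] (5.1) -/

/-- **`∂_t⁺ g̃_t(ζ) = 2 h_t'(W_t)² / (g̃_t(ζ) − W̃_t)` at every alive time** ([LSW] (5.1) /
Lawler (4.34), right-derivative form): for a continuous driving function `W`, a nonempty `*`-hull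
`A` not yet met by the closed hulls at time `s`, and a point `z ∈ ℍ ∖ A` alive at `s`, the image flow `t ↦ imageFlow W A t z` (read at `t.toNNReal`) has the
right derivative `2 d_s² / (g̃_s(ζ) − W̃_s)` at `s`, `d_s = Φ'_{B_s}(0)`. As `u → 0⁺` the
oscillation of `W` on `[s, s + u]` and `4√u` tend to `0`, so the one-step bound
`norm_imageFlow_add_sub_sub_field_le` (at the fixed base hull `B_s`, off `B(0, m_s/2)`) divided by
`u` tends to `0`. [cite: LawlerSchrammWerner2003Restriction, §5 (5.1); Lawler2005, (4.34)] -/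
theorem hasDerivWithinAt_imageFlow_Ici (hW : Continuous W) (hA : IsStarHull A) (hne : A.Nonempty)
    {s : ℝ≥0} (hs : Disjoint (closedHull W s) A) {z : ℂ} (hzH : 0 < z.im) (hzA : z ∉ A)
    (hz : (s : WithTop ℝ≥0) < swallowingTime W z) :
    HasDerivWithinAt (fun t : ℝ ↦ imageFlow W A t.toNNReal z)
      (2 * (starDeriv (slidHull W A s) : ℂ) ^ 2 / (imageFlow W A s z - imageDriver W A s)) (Ici (s : ℝ)) s := by
  have hBs := isStarHull_slidHull_of_disjoint hW hA hs
  obtain ⟨hd0, hd1, -⟩ := starDeriv_spec hBs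
  set d : ℝ := starDeriv (slidHull W A s) with hddef
  -- the margin `m = dist(0, B_s) = 16 ρ`
  obtain ⟨hm0, hmball⟩ := infDist_zero_pos hBs (hne.image _)
  set ρ : ℝ := infDist 0 (slidHull W A s) / 16 with hρdef
  have hρ : 0 < ρ := by positivity
  have hBρ : Disjoint (ball (0 : ℂ) (8 * ρ)) (slidHull W A s) :=
    hmball.mono_left (ball_subset_ball (by rw [hρdef]; linarith))
  -- `E = g̃_s(ζ) − W̃_s ∈ ℍ`, so `‖E‖ > 0`
  set E : ℂ := imageFlow W A s z - imageDriver W A s with hEdef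
  have hzdom : z ∈ domain W s := (mem_domain_iff W s z).2 ⟨hzH, hz⟩
  have hyH : 0 < (map W s z - W s).im := by
    rw [sub_im, ofReal_im, sub_zero]; exact mapsTo_map hW s hzdom
  have hyB : map W s z - W s ∉ slidHull W A s := by
    rintro ⟨a, ha, hae⟩
    have haalive := lt_swallowingTime_of_alive hA hs ha
    have heq : map W s a = map W s z := by
      have := congrArg (· + (W s : ℂ)) hae; simpa using this
    have haim : 0 ≤ a.im := by
      have := hA.isBoundedHull.subset_closure ha
      rwa [show upperHalfPlaneSet = {z : ℂ | 0 < z.im} from rfl, Complex.closure_setOf_lt_im] at this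
    rcases haim.lt_or_eq with hapos | hazero
    · have hadom : a ∈ domain W s := (mem_domain_iff W s a).2 ⟨hapos, haalive⟩
      exact hzA ((injOn_map hW s hadom hzdom heq) ▸ ha)
    · have ha' : a = (((a.re : ℝ)) : ℂ) := Complex.ext rfl (by rw [ofReal_im]; exact hazero.symm)
      rw [ha'] at haalive heq
      have hreal : (map W s (a.re : ℝ)).im = 0 := map_ofReal_im hW haalive
      rw [heq] at hreal
      exact absurd hreal (ne_of_gt (mapsTo_map hW s hzdom))
  have hE0 : 0 < ‖E‖ := by
    have hEim : 0 < E.im := by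
      rw [hEdef, imageFlow_sub_imageDriver, starMap_eq hBs]
      exact hullExt_im_pos (Φ := starRMap _ hBs) ⟨hyH, hyB⟩
    exact norm_pos_iff.2 fun h ↦ by rw [h, zero_im] at hEim; exact lt_irrefl _ hEim
  -- a margin in time for the aliveness of `z`
  obtain ⟨δ₂, hδ₂, halive⟩ : ∃ δ₂ : ℝ, 0 < δ₂ ∧ ∀ u : ℝ≥0, (u : ℝ) < δ₂ →
      ((s + u : ℝ≥0) : WithTop ℝ≥0) < swallowingTime W z := by
    induction hT : swallowingTime W z with
    | top => exact ⟨1, one_pos, fun u _ ↦ WithTop.coe_lt_top _⟩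
    | coe b =>
      rw [hT] at hz
      have hsb : s < b := WithTop.coe_lt_coe.1 hz
      refine ⟨(b : ℝ) - s, by simpa using hsb, fun u hu ↦ WithTop.coe_lt_coe.2 ?_⟩
      rw [← NNReal.coe_lt_coe, NNReal.coe_add]; linarith
  rw [hasDerivWithinAt_iff_tendsto, Metric.tendsto_nhdsWithin_nhds]
  intro ε hε
  -- the smallness constant `c` for `η = osc + 4√u`, and the time window `δ`
  set c : ℝ := min (d ^ 2 * ρ / 2000) (min (‖E‖ / 4) (min (ε * ρ * ‖E‖ / 6000) (ε * ‖E‖ ^ 2 / 360))) with hc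
  have hc0 : 0 < c := lt_min (by positivity) (lt_min (by positivity) (lt_min (by positivity) (by positivity)))
  have hc1 : c ≤ d ^ 2 * ρ / 2000 := min_le_left _ _
  have hc2 : c ≤ ‖E‖ / 4 := (min_le_right _ _).trans (min_le_left _ _)
  have hc3 : c ≤ ε * ρ * ‖E‖ / 6000 := (min_le_right _ _).trans ((min_le_right _ _).trans (min_le_left _ _))
  have hc4 : c ≤ ε * ‖E‖ ^ 2 / 360 := (min_le_right _ _).trans ((min_le_right _ _).trans (min_le_right _ _))
  have hWc : ContinuousAt (fun r : ℝ≥0 ↦ W r) s := hW.continuousAt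
  rw [Metric.continuousAt_iff] at hWc
  obtain ⟨δ₁, hδ₁, hmod⟩ := hWc (c / 2) (by positivity)
  set δ : ℝ := min δ₁ (min δ₂ (min ((c / 8) ^ 2) (min ((ρ / 4) ^ 2) (ε * ρ ^ 2 * ‖E‖ / 1368)))) with hδ
  have hδ0 : 0 < δ := lt_min hδ₁ (lt_min hδ₂ (lt_min (by positivity) (lt_min (by positivity) (by positivity))))
  have hδ_1 : δ ≤ δ₁ := min_le_left _ _
  have hδ_2 : δ ≤ δ₂ := (min_le_right _ _).trans (min_le_left _ _)
  have hδ_c : δ ≤ (c / 8) ^ 2 := (min_le_right _ _).trans ((min_le_right _ _).trans (min_le_left _ _))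
  have hδ_ρ : δ ≤ (ρ / 4) ^ 2 := (min_le_right _ _).trans ((min_le_right _ _).trans ((min_le_right _ _).trans (min_le_left _ _)))
  have hδ_ε : δ ≤ ε * ρ ^ 2 * ‖E‖ / 1368 :=
    (min_le_right _ _).trans ((min_le_right _ _).trans ((min_le_right _ _).trans (min_le_right _ _)))
  refine ⟨δ, hδ0, fun t hts htd ↦ ?_⟩
  have hts' : (s : ℝ) ≤ t := hts
  rw [Real.dist_eq, abs_of_nonneg (sub_nonneg.2 hts')] at htd
  rcases hts'.eq_or_lt with heq | hlt
  · -- `t = s`: the difference quotient expression vanishes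
    rw [← heq]
    simp [hε]
  -- `t = s + u` with `0 < u < δ`
  have ht0 : 0 ≤ t := s.coe_nonneg.trans hts'
  set u : ℝ≥0 := ⟨t - s, sub_nonneg.2 hts'⟩ with hudef
  have hu_coe : (u : ℝ) = t - s := rfl
  have hu0 : 0 < u := by rw [← NNReal.coe_pos, hu_coe]; linarith
  have huδ : (u : ℝ) < δ := by rw [hu_coe]; exact htd
  have htu : t.toNNReal = s + u := by
    apply NNReal.eq; rw [Real.coe_toNNReal t ht0, NNReal.coe_add, hu_coe]; ring
  -- the hypotheses of the one-step bound at base `s`, step `u`, oscillation `c/2`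
  have hS : ∀ r : ℝ≥0, r ≤ u → |W (s + r) - W s| ≤ c / 2 := by
    intro r hr
    have hdist : dist (s + r) s < δ₁ := by
      rw [NNReal.dist_eq, NNReal.coe_add, add_sub_cancel_left, abs_of_nonneg r.coe_nonneg]
      exact lt_of_le_of_lt (NNReal.coe_le_coe.2 hr) (huδ.trans_le hδ_1)
    have := hmod hdist
    rw [Real.dist_eq] at this
    exact this.le
  have hsqrt : 4 * Real.sqrt u ≤ c / 2 := by
    have h1 : Real.sqrt u ≤ c / 8 := by
      rw [Real.sqrt_le_left (by positivity)]; exact (huδ.le.trans hδ_c)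
    linarith
  have hηc : stepSize (c / 2) u ≤ c := by rw [stepSize]; linarith
  have hη0 : 0 < stepSize (c / 2) u := by rw [stepSize]; positivity
  have hηρ : stepSize (c / 2) u ≤ ρ := by
    refine hηc.trans (hc1.trans ?_)
    rw [div_le_iff₀ (by norm_num : (0 : ℝ) < 2000)]
    have hd2 : d ^ 2 * ρ ≤ 1 * ρ := mul_le_mul_of_nonneg_right (pow_le_one₀ hd0.le hd1) hρ.le
    linarith
  have hu4 : (u : ℝ) ≤ (ρ / 4) ^ 2 := huδ.le.trans hδ_ρ
  have hη2 : stepSize (c / 2) u ≤ starDeriv (slidHull W A s) ^ 2 * ρ / 2000 := hηc.trans hc1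
  have hEη : 4 * stepSize (c / 2) u ≤ ‖imageFlow W A s z - imageDriver W A s‖ := by
    change 4 * stepSize (c / 2) u ≤ ‖E‖; linarith
  have hzu : ((s + u : ℝ≥0) : WithTop ℝ≥0) < swallowingTime W z := halive u (huδ.trans_le hδ_2)
  obtain ⟨hmain, -⟩ := norm_imageFlow_add_sub_sub_field_le hW hA hs hρ hBρ hu0 hS hηρ hu4 hη2 hzH hzA hzu hEη
  -- rewrite the difference quotient
  have hfun : (fun t : ℝ ↦ imageFlow W A t.toNNReal z) t - (fun t : ℝ ↦ imageFlow W A t.toNNReal z) s -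
      ((t : ℝ) - s) • (2 * (starDeriv (slidHull W A s) : ℂ) ^ 2 / (imageFlow W A s z - imageDriver W A s)) =
      (imageFlow W A (s + u) z - imageFlow W A s z) -
        2 * (starDeriv (slidHull W A s) : ℂ) ^ 2 * u / (imageFlow W A s z - imageDriver W A s) := by
    simp only [Real.toNNReal_coe, htu, Complex.real_smul, ← hu_coe]
    ring
  rw [Real.dist_eq, sub_zero, hfun, Real.norm_eq_abs, abs_of_nonneg (sub_nonneg.2 hts'), ← hu_coe]
  have hupos : (0 : ℝ) < u := hu0
  rw [abs_of_nonneg (by positivity), inv_mul_lt_iff₀ hupos]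
  refine lt_of_le_of_lt hmain ?_
  -- the bound divided by `u` is `< ε`
  change (u : ℝ) * (1000 * stepSize (c / 2) u / ρ + 228 * u / ρ ^ 2) / ‖E‖ + 60 * u * stepSize (c / 2) u / ‖E‖ ^ 2 < u * ε
  have t1 : 1000 * stepSize (c / 2) u / ρ / ‖E‖ ≤ ε / 6 := by
    rw [div_div, div_le_iff₀ (by positivity)]
    have := hηc.trans hc3
    linarith
  have t2 : 228 * (u : ℝ) / ρ ^ 2 / ‖E‖ ≤ ε / 6 := by
    rw [div_div, div_le_iff₀ (by positivity)]
    have := huδ.le.trans hδ_ε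
    linarith
  have t3 : 60 * stepSize (c / 2) u / ‖E‖ ^ 2 ≤ ε / 6 := by
    rw [div_le_iff₀ (by positivity)]
    have := hηc.trans hc4
    linarith
  have hsplit : (u : ℝ) * (1000 * stepSize (c / 2) u / ρ + 228 * u / ρ ^ 2) / ‖E‖ + 60 * u * stepSize (c / 2) u / ‖E‖ ^ 2 =
      u * (1000 * stepSize (c / 2) u / ρ / ‖E‖ + 228 * u / ρ ^ 2 / ‖E‖ + 60 * stepSize (c / 2) u / ‖E‖ ^ 2) := by
    field_simp
  rw [hsplit]
  have : 1000 * stepSize (c / 2) u / ρ / ‖E‖ + 228 * u / ρ ^ 2 / ‖E‖ + 60 * stepSize (c / 2) u / ‖E‖ ^ 2 < ε := by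
    linarith
  exact mul_lt_mul_of_pos_left this hupos

end Loewner

end Literature.Probability.RandomPlanarGeometry

end
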